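import Literature.Probability.Percolation.CutPointArms
import Literature.Probability.Percolation.TriShiftedCrossings
import HarnessLib

/-!
# The pivotal sites of the one-arm event: one arm inside, four arms locally, one arm outside (proofs only)

Topic `Literature/Probability/Percolation`; family `crit-perc`, statement **crit-perc.S16**
(`Literature.Probability.Percolation.triTheta_exponent`). Proofs only (no new definition, no new
named fact). The probabilistic form of the decomposition of a pivotal site of the one-arm event
`{0 ↔ ∂Λ_N}` (Nolin 2008, §6.2, proof of Thm. 27, Case 1 [arXiv 0711.4948: Thm. 26], display
after "It is not hard to check that `R(v) ⊆ S_{2^l, 2^{l+3}}`":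

  `P̃_t(v is pivotal for {∂S_{2^{k₀}} ↝ ∂S_{2^K}})
     ≤ P̃_t(∂S_{2^{k₀}} ↝ ∂S_{2^l}) · P̃_t(∂S_{2^{l+3}} ↝ ∂S_{2^K}) · P̃_t(v ↝^{4,σ₄} ∂S_{2^l}(v))`

"by independence of the three events, since they are defined in terms of sites in disjoint
sets"; Werner 2009, Lecture 6, §5, "Using differential inequalities for the one-arm event";
Kesten 1987, Lemma 8), for the tree's one-arm event `triOneArm N`, its pivotal sites
(`IsPivotal`, summed in `oneArmPivotalSum`, `WernerPivotalEstimates.lean`) and the tree's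
(non-cyclic) four-arm event `armEvent ![T, F, T, F]` / `fourArmProbAt`:

* `isPivotal_triOneArm_subset` — for `|v|_𝕋 = k`, `d ≥ 1`, `2d + 1 ≤ k ≤ N - 2d`, `m + d + 1 ≤ k`,
  `k + d + 1 ≤ m' ≤ N`: `{v pivotal for 0 ↔ ∂Λ_N} ⊆ {0 ↔ ∂Λ_m} ∩ (v + Π̂(r₀, d)) ∩ {∂Λ_{m'} ↝ ∂Λ_N}`,
  where `v + Π̂(r₀, d)` is the translate to `v` of `armEvent ![T,F,T,F] r₀ d` (`1 ≤ r₀ ≤ d`;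
  from `relabel_shift_mem_armEvent_of_isPivotal_triOneArm`, `CutPointArms.lean`) and
  `{∂Λ_{m'} ↝ ∂Λ_N} = armEvent ![T] m' N` (an open arm across `Λ_N \ Λ_{m'}`): the open path of
  `ω ∪ {v}` from `0` through `v` to `∂Λ_N` provides the inner and the outer arm.
* `measureReal_isPivotal_triOneArm_le` — hence, the three events being determined by the
  disjoint site sets `Λ_m`, `v + (Λ_d \ Λ_{r₀-1})`, `Λ_N \ Λ_{m'-1}`,
  `P_t(v pivotal for 0 ↔ ∂Λ_N) ≤ P_t(0 ↔ ∂Λ_m) · π̂_t(r₀, d) · P_t(∂Λ_{m'} ↝ ∂Λ_N)` with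
  `π̂_t(r₀, d) = fourArmProbAt t r₀ d` (translation invariance of `P_t`).

Also: `mem_triOneArm_of_pathIn_triNorm` (an open path from `0` to `|·|_𝕋 ≥ n` realises
`triOneArm n`), `mem_armEvent_one_of_pathIn_ball` (an open path inside `Λ_N` from `|·|_𝕋 < m'` to
`∂Λ_N` realises `armEvent ![T] m' N`), `triNorm_le_add_of_mem_shift_annulus` /
`le_triNorm_of_mem_shift_annulus` (norm bounds on `v + (Λ_d \ Λ_{r₀-1})`).

The summation over `v` (Werner's `Σ_x P_p(x pivotal) ≤ c n² π̂_p(n) P_p(0 ↔ ∂Λ_n)`), which needs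
the one-arm quasi-multiplicativity of `OneArmQuasiMult.lean` and the a priori bounds on `π̂`, is
not done here.

## References

* P. Nolin, Near-critical percolation in two dimensions, *Electron. J. Probab.* 13 (2008),
  §6.2, proof of Thm. 27, Case 1 [arXiv 0711.4948: Thm. 26] [Nolin2008].
* W. Werner, *Lectures on two-dimensional critical percolation*, IAS/Park City Math. Ser. 16
  (2009), Lecture 6, §5 [WernerPCMI2009].
* H. Kesten, Scaling relations for 2D-percolation, *Comm. Math. Phys.* 109 (1987), Lemma 8
  [KestenScalingCMP1987].
* G. Grimmett, *Percolation*, 2nd ed. (1999), §1.3 (product measure: events on disjoint site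
  sets are independent) [GrimmettPercolation1999].

Tree: `relabel_shift_mem_armEvent_of_isPivotal_triOneArm`, `triNorm_add_le`
(`CutPointArms.lean`), `PathIn.split_at`, `isPivotal_iff_insert_mem_and_notMem`,
`inter_insert_diff_subset` (`ParaPivotalArms.lean`), `mem_armEvent_one_iff_exists_pathIn`,
`triNorm_neg` (`ArmEventsAPriori.lean`), `determinedBy_triOneArm`, `isUpperSet_triOneArm`
(`NearCriticalScaling.lean`), `determinedBy_armEvent` (`ArmEventsStructure.lean`),
`armEvent_mono_left`, `triAnnulus` (`ArmEventsProofs.lean`), `determinedBy_preimage_relabel`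
(`TriShiftedCrossings.lean`), `sitePercolation_real_inter_of_disjoint`,
`sitePercolation_real_preimage_relabel` (`SitePercolationMeasure.lean`), `DeterminedBy.mono/inter`
(`PercolationEvents.lean`), `fourArmProbAt` (`WernerPivotalEstimates.lean`).
-/

noncomputable section

open MeasureTheory Set

namespace Literature.Probability.Percolation

open LatticeModels

/-! ### Arms from paths, hexagonal form -/

/-- An open path from the origin to a site of `𝕋`-norm `≥ n` realises `triOneArm n` (first exit
from `{|·|_𝕋 < n}`; the hexagonal-norm form of `mem_triOneArm_of_pathIn`). [folklore] -/
theorem mem_triOneArm_of_pathIn_triNorm {n : ℕ} {ω : SiteConfig (Site 2)} {y : Site 2}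
    (hp : PathIn triGraph ω 0 y) (hyn : (n : ℤ) ≤ triNorm y) : ω ∈ triOneArm n := by
  rcases Nat.eq_zero_or_pos n with rfl | hn
  · refine ⟨0, by simp, ?_⟩
    rw [mem_siteConnIn_iff_pathIn]
    exact PathIn.refl ⟨by simp, hp.left_mem⟩
  · obtain ⟨a, b, ha, hb, hbω, hab, hpa⟩ :=
      hp.exit (R := {v | triNorm v < n}) (by simpa using hn) (by simpa using hyn)
    simp only [Set.mem_setOf_eq, not_lt] at ha hb
    have hb' : triNorm b = n :=
      le_antisymm ((triNorm_le_triNorm_add_one_of_adj hab).trans (by omega)) hb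
    refine ⟨b, mem_triSphere_iff.2 hb', ?_⟩
    rw [mem_siteConnIn_iff_pathIn]
    refine (hpa.mono ?_).tail hab ⟨?_, hbω⟩
    · rintro v ⟨hv, hvω⟩
      exact ⟨by simpa using (le_of_lt hv), hvω⟩
    · simpa using hb'.le

/-- An open path inside `Λ_N` from a site of `𝕋`-norm `< m'` to a site of `∂Λ_N` realises the
one-arm annulus event `armEvent ![true] m' N` (last exit from `{|·|_𝕋 < m'}`). [folklore] -/
theorem mem_armEvent_one_of_pathIn_ball {m' N : ℕ} {ω : SiteConfig (Site 2)} {S : Set (Site 2)}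
    {x y : Site 2} (hp : PathIn triGraph S x y) (hS : S ⊆ (↑(triBall N) : Set (Site 2)) ∩ ω)
    (hx : triNorm x < m') (hy : triNorm y = N) (hmN : m' ≤ N) : ω ∈ armEvent ![true] m' N := by
  set C : Set (Site 2) := {z | triNorm z < m'} with hC
  have hxC : x ∈ C := hx
  have hyC : y ∉ C := by simp only [hC, mem_setOf_eq, not_lt, hy]; exact_mod_cast hmN
  obtain ⟨a, b, haC, -, hbC, hab, hpath⟩ := hp.last_exit hxC hyC
  simp only [hC, mem_setOf_eq, not_lt] at haC hbC
  have hb' : triNorm b = m' :=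
    le_antisymm ((triNorm_le_triNorm_add_one_of_adj hab).trans (by omega)) hbC
  rw [mem_armEvent_one_iff_exists_pathIn hmN]
  refine ⟨b, mem_triSphere_iff.2 hb', y, mem_triSphere_iff.2 hy, hpath.mono ?_⟩
  rintro z ⟨hzS, hzC⟩
  simp only [hC, mem_setOf_eq, not_lt] at hzC
  obtain ⟨hzN, hzω⟩ := hS hzS
  rw [Finset.mem_coe, mem_triBall_iff] at hzN
  exact ⟨⟨hzC, hzN⟩, by simpa using hzω⟩

/-! ### The inclusion -/

section Inclusion

variable {N d r₀ k m m' : ℕ} {v : Site 2}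

/-- Sites of the translated annulus `v + (Λ_d \ Λ_{r₀-1})` have `𝕋`-norm at most `|v|_𝕋 + d`. [folklore] -/
theorem triNorm_le_add_of_mem_shift_annulus {z : Site 2}
    (hz : z ∈ (fun u => u + v) '' (↑(triAnnulus r₀ d) : Set (Site 2))) :
    triNorm z ≤ triNorm v + d := by
  obtain ⟨u, hu, rfl⟩ := hz
  rw [Finset.mem_coe, mem_triAnnulus] at hu
  have := triNorm_add_le u v
  show triNorm (u + v) ≤ triNorm v + d
  omega

/-- Sites of the translated annulus `v + (Λ_d \ Λ_{r₀-1})` have `𝕋`-norm at least `|v|_𝕋 - d`. [folklore] -/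
theorem le_triNorm_of_mem_shift_annulus {z : Site 2}
    (hz : z ∈ (fun u => u + v) '' (↑(triAnnulus r₀ d) : Set (Site 2))) :
    triNorm v - d ≤ triNorm z := by
  obtain ⟨u, hu, rfl⟩ := hz
  rw [Finset.mem_coe, mem_triAnnulus] at hu
  have := triNorm_add_le (u + v) (-u)
  rw [add_neg_cancel_comm, triNorm_neg] at this
  show triNorm v - d ≤ triNorm (u + v)
  omega

/-- **A pivotal site of the one-arm event: one arm inside, four arms locally, one arm outside**
(Nolin 2008, §6.2, proof of Thm. 27, Case 1: "`P̃_t(v pivotal) ≤ P̃_t({∂S_{2^{k₀}} ↝ ∂S_{2^l}} ∩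
{∂S_{2^{l+3}} ↝ ∂S_{2^K}} ∩ {v ↝^{4,σ₄} ∂S_{2^l}(v)})`"; Werner 2009, Lecture 6, §5). For
`|v|_𝕋 = k`, `1 ≤ r₀ ≤ d`, `2d + 1 ≤ k`, `k + 2d ≤ N`, `m + d + 1 ≤ k` and `k + d + 1 ≤ m' ≤ N`: if
`v` is pivotal for `{0 ↔ ∂Λ_N}` then `0 ↔ ∂Λ_m` (the open path of `ω ∪ {v}` from `0` reaches a
neighbour of `v` before `v`), `ω - v ∈ armEvent ![T,F,T,F] r₀ d` (`CutPointArms.lean`), and an open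
arm crosses `Λ_N \ Λ_{m'}` (the same path after `v`). [cite: Nolin2008, §6.2, proof of Thm. 27, Case 1 (arXiv 0711.4948: Thm. 26)] [cite: WernerPCMI2009, Lecture 6, §5 ("Using differential inequalities for the one-arm event")] -/
theorem isPivotal_triOneArm_subset (hr₀ : 1 ≤ r₀) (hrd : r₀ ≤ d) (hk : triNorm v = k)
    (hkd : 2 * d + 1 ≤ k) (hkN : k + 2 * d ≤ N) (hm : m + d + 1 ≤ k) (hm' : k + d + 1 ≤ m')
    (hm'N : m' ≤ N) :
    {ω : SiteConfig (Site 2) | IsPivotal (triOneArm N) v ω} ⊆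
      triOneArm m ∩ (SiteConfig.relabel (triShiftIso (-v)).toEquiv ⁻¹'
          armEvent ![true, false, true, false] r₀ d ∩ armEvent ![true] m' N) := by
  intro ω hω
  have hd : 1 ≤ d := hr₀.trans hrd
  have hloc := relabel_shift_mem_armEvent_of_isPivotal_triOneArm (N := N) (v := v) (ω := ω) hd
    (by rw [hk]; exact_mod_cast hkd) (by rw [hk]; exact_mod_cast hkN) hω
  -- the open path of `ω ∪ {v}` through `v`
  have hω' := hω
  rw [Set.mem_setOf_eq, isPivotal_iff_insert_mem_and_notMem (isUpperSet_triOneArm N)] at hω'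
  obtain ⟨⟨y, hy, hconn⟩, hnot⟩ := hω'
  rw [mem_triSphere_iff] at hy
  set Λ : Set (Site 2) := ↑(triBall N) with hΛ
  have hγ : PathIn triGraph (Λ ∩ insert v ω) 0 y := PathIn.of_mem_siteConnIn hconn
  have hAsub : (Λ ∩ insert v ω) \ {v} ⊆ Λ ∩ (ω \ {v}) := inter_insert_diff_subset Λ v ω
  have hv0 : (v : Site 2) ≠ 0 := by
    intro h; rw [h] at hk; simp [triNorm] at hk; omega
  have hyv : y ≠ v := by intro h; rw [h, hk] at hy; omega
  rcases hγ.split_at v with havoid | ⟨hP, hS⟩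
  · exact (hnot ⟨y, mem_triSphere_iff.2 hy, (havoid.mono hAsub).mem_siteConnIn⟩).elim
  obtain ⟨a₁, ha₁, hpre⟩ := hP.resolve_left hv0.symm
  obtain ⟨b₁, hb₁, hsuf⟩ := hS.resolve_left hyv
  refine ⟨?_, armEvent_mono_left _ hr₀ hrd hloc, ?_⟩
  · -- inner arm: `0 ↔ ∂Λ_m`
    refine mem_triOneArm_of_pathIn_triNorm (hpre.mono fun z hz => (hAsub hz).2.1) ?_
    have := triNorm_le_triNorm_add_one_of_adj ha₁
    omega
  · -- outer arm: `∂Λ_{m'} ↝ ∂Λ_N`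
    refine mem_armEvent_one_of_pathIn_ball hsuf.symm (fun z hz => ⟨(hAsub hz).1, (hAsub hz).2.1⟩)
      ?_ hy hm'N
    have := triNorm_le_triNorm_add_one_of_adj hb₁.symm
    omega

end Inclusion

/-! ### The probability bound -/

section Bound

variable {N d r₀ k m m' : ℕ} {v : Site 2}

/-- The translate to `v` of the four-arm event is determined by the sites of the translated
annulus `v + (Λ_d \ Λ_{r₀-1})`. [folklore] -/
theorem determinedBy_preimage_shift_armEvent {κ : Fin 4 → Bool} (hrd : r₀ ≤ d) (v : Site 2) :
    DeterminedBy (SiteConfig.relabel (triShiftIso (-v)).toEquiv ⁻¹' armEvent κ r₀ d)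
      (↑((triAnnulus r₀ d).image fun u => u + v) : Set (Site 2)) := by
  have h := determinedBy_preimage_relabel (triShiftIso (-v)).toEquiv (determinedBy_armEvent κ hrd)
  rw [Finset.coe_image]
  convert h using 1
  ext z
  simp only [Set.mem_image, Finset.mem_coe]
  constructor
  · rintro ⟨u, hu, rfl⟩
    refine ⟨u, hu, ?_⟩
    apply (triShiftIso (-v)).toEquiv.injective
    rw [Equiv.apply_symm_apply]
    show u = triShiftIso (-v) (u + v)
    simp
  · rintro ⟨u, hu, rfl⟩
    refine ⟨u, hu, ?_⟩
    apply (triShiftIso (-v)).toEquiv.injective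
    rw [Equiv.apply_symm_apply]
    show triShiftIso (-v) (u + v) = u
    simp

/-- **The pivotal bound for the one-arm event** (Nolin 2008, §6.2, proof of Thm. 27, Case 1, "by
independence of the three events, since they are defined in terms of sites in disjoint sets";
Werner 2009, Lecture 6, §5). Under the hypotheses of `isPivotal_triOneArm_subset`,
`P_t(v pivotal for 0 ↔ ∂Λ_N) ≤ P_t(0 ↔ ∂Λ_m) · π̂_t(r₀, d) · P_t(armEvent ![T] m' N)`,
`π̂_t(r₀, d) = fourArmProbAt t r₀ d`: the three events are determined by the pairwise disjoint site
sets `Λ_m`, `v + (Λ_d \ Λ_{r₀-1})` (norms in `[k - d, k + d]`) and `Λ_N \ Λ_{m'-1}`, hence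
independent under the product measure `P_t`, and `P_t(v + Π̂) = P_t(Π̂)` by translation
invariance. [cite: Nolin2008, §6.2, proof of Thm. 27, Case 1 (arXiv 0711.4948: Thm. 26)] [cite: WernerPCMI2009, Lecture 6, §5 ("Using differential inequalities for the one-arm event")] -/
theorem measureReal_isPivotal_triOneArm_le (t : unitInterval) (hr₀ : 1 ≤ r₀) (hrd : r₀ ≤ d)
    (hk : triNorm v = k) (hkd : 2 * d + 1 ≤ k) (hkN : k + 2 * d ≤ N) (hm : m + d + 1 ≤ k)
    (hm' : k + d + 1 ≤ m') (hm'N : m' ≤ N) :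
    (triSitePercolation t).real {ω | IsPivotal (triOneArm N) v ω} ≤
      (triSitePercolation t).real (triOneArm m) *
        (fourArmProbAt t r₀ d * (triSitePercolation t).real (armEvent ![true] m' N)) := by
  classical
  set e := (triShiftIso (-v)).toEquiv with he
  set A : Set (SiteConfig (Site 2)) := triOneArm m with hA
  set B : Set (SiteConfig (Site 2)) :=
    SiteConfig.relabel e ⁻¹' armEvent ![true, false, true, false] r₀ d with hB
  set C : Set (SiteConfig (Site 2)) := armEvent ![true] m' N with hC
  -- determining sets
  set F : Finset (Site 2) := triBall m with hF
  set G : Finset (Site 2) := (triAnnulus r₀ d).image fun u => u + v with hG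
  set H : Finset (Site 2) := triAnnulus m' N with hH
  have hAF : DeterminedBy A ↑F := determinedBy_triOneArm m
  have hBG : DeterminedBy B ↑G := determinedBy_preimage_shift_armEvent hrd v
  have hCH : DeterminedBy C ↑H := determinedBy_armEvent _ hm'N
  have hGmem : ∀ z ∈ G, triNorm v - d ≤ triNorm z ∧ triNorm z ≤ triNorm v + d := by
    intro z hz
    have hz' : z ∈ (fun u => u + v) '' (↑(triAnnulus r₀ d) : Set (Site 2)) := by
      rw [← Finset.coe_image]; exact Finset.mem_coe.2 hz
    exact ⟨le_triNorm_of_mem_shift_annulus hz', triNorm_le_add_of_mem_shift_annulus hz'⟩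
  have hFG : Disjoint F G := by
    rw [Finset.disjoint_left]
    intro z hzF hzG
    rw [hF, mem_triBall_iff] at hzF
    have := (hGmem z hzG).1
    omega
  have hGH : Disjoint G H := by
    rw [Finset.disjoint_left]
    intro z hzG hzH
    rw [hH, mem_triAnnulus] at hzH
    have := (hGmem z hzG).2
    omega
  have hFH : Disjoint F H := by
    rw [Finset.disjoint_left]
    intro z hzF hzH
    rw [hF, mem_triBall_iff] at hzF
    rw [hH, mem_triAnnulus] at hzH
    omega
  have hBC : DeterminedBy (B ∩ C) ↑(G ∪ H) :=
    (hBG.mono (by rw [Finset.coe_union]; exact subset_union_left)).inter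
      (hCH.mono (by rw [Finset.coe_union]; exact subset_union_right))
  have hFGH : Disjoint F (G ∪ H) := Finset.disjoint_union_right.2 ⟨hFG, hFH⟩
  -- independence and translation invariance
  have h1 : (triSitePercolation t).real (A ∩ (B ∩ C)) =
      (triSitePercolation t).real A * (triSitePercolation t).real (B ∩ C) :=
    sitePercolation_real_inter_of_disjoint t hAF hBC hFGH
  have h2 : (triSitePercolation t).real (B ∩ C) =
      (triSitePercolation t).real B * (triSitePercolation t).real C :=
    sitePercolation_real_inter_of_disjoint t hBG hCH hGH
  have h3 : (triSitePercolation t).real B = fourArmProbAt t r₀ d := by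
    rw [fourArmProbAt, hB, triSitePercolation]
    exact sitePercolation_real_preimage_relabel e t _
  calc (triSitePercolation t).real {ω | IsPivotal (triOneArm N) v ω}
      ≤ (triSitePercolation t).real (A ∩ (B ∩ C)) :=
        measureReal_mono (isPivotal_triOneArm_subset hr₀ hrd hk hkd hkN hm hm' hm'N)
    _ = (triSitePercolation t).real A *
          (fourArmProbAt t r₀ d * (triSitePercolation t).real C) := by rw [h1, h2, h3]

end Bound

end Literature.Probability.Percolation
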